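import Mathlib
import Summits.CriticalPhenomena.CardyFormulaZ2.Theorems.CardySelfRefinementGradientComparabilityStubLevelGapTransport
import Summits.CriticalPhenomena.CardyFormulaZ2.Theorems.CardySelfRefinementGradientComparabilityStubLevelCurveIFT
import HarnessLib

/-!
# Level-set transport of the gradient: the calculus of leaves (pure analysis)

Crux `stmt-CriticalPhenomena-10269`
(`Summit.CriticalPhenomena.CardyFormulaZ2.Theses.CardySelfRefinement.GradientComparability`),
line **monotone-product-coordinates**, support for stub `stub_levelSetTransport`.

Pure real analysis about a `C²` function `Φ : ℝ² → ℝ` (the crossing polynomial at fixed mesh);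
nothing percolation-specific.  Notation: `Φ_ρ q = fderiv ℝ Φ q (1,0)`, `Φ_c q = fderiv ℝ Φ q (0,1)`,
second partials `fderiv ℝ (fderiv ℝ Φ) q u w` (symmetric in `u, w`: Schwarz).

* `abs_le_of_hasDerivAt_of_left_lip` — a one-sided Lipschitz estimate bounds the derivative.
* THE BULK IDENTITY (★).  Along a level leaf `c = ℓ(ρ)` (`ℓ' = -Φ_ρ/Φ_c`, `Φ_c > 0`),
  `d/dρ log Φ_c(ρ, ℓ ρ) = ∂_c (Φ_ρ/Φ_c)(ρ, ℓ ρ)`; hence if `|∂_c(Φ_ρ/Φ_c)| ≤ Θ` on the leaf then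
  `Φ_c` changes by at most the factor `exp (Θ |ρ - ρ'|)` along it (`bulk_leaf_transport`).
* THE CORNER (TWIN) IDENTITY.  Along a level leaf written as a graph over `c`, `ρ = h(c)`
  (`h' = -Φ_c/Φ_ρ`, `Φ_ρ ≠ 0`), `d/dc log |Φ_ρ(h c, c)| = ∂_ρ (Φ_c/Φ_ρ)(h c, c)`.  With
  `|∂_ρ(Φ_c/Φ_ρ)| ≤ Θ` at level points of a strip `[ρlo, 1] × [c₀, cb]` and `Φ_c ≥ 0`, the leaf
  through a level point `q₀` with `Φ_ρ q₀ < 0` can be continued upwards in `c` (local implicit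
  function theorem, `ContDiffAt.implicitFunction`), with `ρ` non-decreasing, until it reaches the
  edge `ρ = 1` or the top `c = cb`, and `|Φ_ρ|` changes by at most `exp (Θ · length)` along it
(this file: the local step `corner_leaf_local`; the continuation `corner_leaf_transport`, its mirror
  image `corner_leaf_transport_down` for `Φ_ρ q₀ > 0` and `corner_endpoint` are in the sequel
  `…StubLevelSetTransportCorner`).
-/

noncomputable section

namespace Summit.CriticalPhenomena.CardyFormulaZ2.Theorems.CardySelfRefinement

open scoped Topology
open Filter Set

/-! ## One-sided Lipschitz estimates bound the derivative -/

/-- If `f` has derivative `f'` at `x` and `|f z - f x| ≤ C |z - x|` for `z` in a punctured LEFT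
neighbourhood `(x - ε, x)`, then `|f'| ≤ C` (the derivative is the limit of the left slopes). -/
theorem abs_le_of_hasDerivAt_of_left_lip {f : ℝ → ℝ} {f' x C ε : ℝ} (hf : HasDerivAt f f' x)
    (hε : 0 < ε) (hlip : ∀ z ∈ Set.Ioo (x - ε) x, |f z - f x| ≤ C * |z - x|) : |f'| ≤ C := by
  have ht : Tendsto (slope f x) (𝓝[<] x) (𝓝 f') := by
    have h := hf.hasDerivWithinAt (s := Set.Iio x)
    rwa [hasDerivWithinAt_iff_tendsto_slope' (by simp)] at h
  refine le_of_tendsto ht.abs ?_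
  filter_upwards [Ioo_mem_nhdsLT (show x - ε < x by linarith)] with z hz
  have hzx : z - x < 0 := by linarith [hz.2]
  rw [slope_def_field, abs_div, div_le_iff₀ (abs_pos.2 hzx.ne)]
  exact hlip z hz

/-- If `f` has derivative `f'` at `x` and `|f z - f x| ≤ C |z - x|` for `z` in a punctured RIGHT
neighbourhood `(x, x + ε)`, then `|f'| ≤ C`. -/
theorem abs_le_of_hasDerivAt_of_right_lip {f : ℝ → ℝ} {f' x C ε : ℝ} (hf : HasDerivAt f f' x)
    (hε : 0 < ε) (hlip : ∀ z ∈ Set.Ioo x (x + ε), |f z - f x| ≤ C * |z - x|) : |f'| ≤ C := by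
  have ht : Tendsto (slope f x) (𝓝[>] x) (𝓝 f') := by
    have h := hf.hasDerivWithinAt (s := Set.Ioi x)
    rwa [hasDerivWithinAt_iff_tendsto_slope' (by simp)] at h
  refine le_of_tendsto ht.abs ?_
  filter_upwards [Ioo_mem_nhdsGT (show x < x + ε by linarith)] with z hz
  have hzx : 0 < z - x := by linarith [hz.1]
  rw [slope_def_field, abs_div, div_le_iff₀ (abs_pos.2 hzx.ne')]
  exact hlip z hz

/-! ## Second derivatives along curves and lines -/

/-- A continuous bilinear-type map `ℝ² →L (ℝ² →L ℝ)` in coordinates (first argument). -/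
theorem clm₂_apply_prod (L : (ℝ × ℝ) →L[ℝ] (ℝ × ℝ) →L[ℝ] ℝ) (h w : ℝ × ℝ) :
    L h w = h.1 * L (1, 0) w + h.2 * L (0, 1) w := by
  have : h = h.1 • ((1 : ℝ), (0 : ℝ)) + h.2 • ((0 : ℝ), (1 : ℝ)) := by ext <;> simp
  conv_lhs => rw [this]
  simp only [map_add, map_smul, add_apply, FunLike.coe_smul, Pi.smul_apply, smul_eq_mul]

/-- A `C²` function has a differentiable derivative. -/
theorem differentiable_fderiv_two {Φ : ℝ × ℝ → ℝ} (hΦ : ContDiff ℝ 2 Φ) :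
    Differentiable ℝ (fderiv ℝ Φ) :=
  (hΦ.fderiv_right (m := 1) (by norm_num)).differentiable (by norm_num)

/-- Chain rule for a directional first derivative along a curve, one-sided version: the derivative
of `x ↦ Φ'(γ x) w` within `s` at `t` is the second derivative `Φ''(γ t) (γ' t) w`. -/
theorem hasDerivWithinAt_fderiv_along {Φ : ℝ × ℝ → ℝ} (hΦ : ContDiff ℝ 2 Φ) {γ : ℝ → ℝ × ℝ}
    {γ' : ℝ × ℝ} {s : Set ℝ} {t : ℝ} (hγ : HasDerivWithinAt γ γ' s t) (w : ℝ × ℝ) :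
    HasDerivWithinAt (fun x => fderiv ℝ Φ (γ x) w) (fderiv ℝ (fderiv ℝ Φ) (γ t) γ' w) s t := by
  have h1 : HasDerivWithinAt (fun x => fderiv ℝ Φ (γ x)) (fderiv ℝ (fderiv ℝ Φ) (γ t) γ') s t :=
    ((differentiable_fderiv_two hΦ) (γ t)).hasFDerivAt.comp_hasDerivWithinAt t hγ
  have h2 := h1.clm_apply (hasDerivWithinAt_const t s w)
  simpa using h2

/-- Chain rule for a directional first derivative along a curve: the derivative of
`x ↦ Φ'(γ x) w` at `t` is `Φ''(γ t) (γ' t) w`. -/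
theorem hasDerivAt_fderiv_along {Φ : ℝ × ℝ → ℝ} (hΦ : ContDiff ℝ 2 Φ) {γ : ℝ → ℝ × ℝ}
    {γ' : ℝ × ℝ} {t : ℝ} (hγ : HasDerivAt γ γ' t) (w : ℝ × ℝ) :
    HasDerivAt (fun x => fderiv ℝ Φ (γ x) w) (fderiv ℝ (fderiv ℝ Φ) (γ t) γ' w) t := by
  rw [← hasDerivWithinAt_univ] at hγ ⊢
  exact hasDerivWithinAt_fderiv_along hΦ hγ w

/-- The `ρ`-derivative of the inverse slope `S(r) = Φ_c(r,c)/Φ_ρ(r,c)` where `Φ_ρ ≠ 0`. -/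
theorem hasDerivAt_levelInvSlope {Φ : ℝ × ℝ → ℝ} (hΦ : ContDiff ℝ 2 Φ) (r c : ℝ)
    (hne : fderiv ℝ Φ (r, c) (1, 0) ≠ 0) :
    HasDerivAt (fun x => fderiv ℝ Φ (x, c) (0, 1) / fderiv ℝ Φ (x, c) (1, 0))
      ((fderiv ℝ (fderiv ℝ Φ) (r, c) (1, 0) (0, 1) * fderiv ℝ Φ (r, c) (1, 0) -
        fderiv ℝ Φ (r, c) (0, 1) * fderiv ℝ (fderiv ℝ Φ) (r, c) (1, 0) (1, 0)) /
        fderiv ℝ Φ (r, c) (1, 0) ^ 2) r := by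
  have hγ : HasDerivAt (fun x : ℝ => ((x, c) : ℝ × ℝ)) ((1 : ℝ), (0 : ℝ)) r :=
    (hasDerivAt_id r).prodMk (hasDerivAt_const r c)
  exact (hasDerivAt_fderiv_along hΦ hγ (0, 1)).div (hasDerivAt_fderiv_along hΦ hγ (1, 0)) hne

/-- The `c`-derivative of the slope `R(y) = Φ_ρ(ρ,y)/Φ_c(ρ,y)` where `Φ_c ≠ 0`. -/
theorem hasDerivAt_levelSlope {Φ : ℝ × ℝ → ℝ} (hΦ : ContDiff ℝ 2 Φ) (ρ c : ℝ)
    (hne : fderiv ℝ Φ (ρ, c) (0, 1) ≠ 0) :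
    HasDerivAt (fun y => fderiv ℝ Φ (ρ, y) (1, 0) / fderiv ℝ Φ (ρ, y) (0, 1))
      ((fderiv ℝ (fderiv ℝ Φ) (ρ, c) (0, 1) (1, 0) * fderiv ℝ Φ (ρ, c) (0, 1) -
        fderiv ℝ Φ (ρ, c) (1, 0) * fderiv ℝ (fderiv ℝ Φ) (ρ, c) (0, 1) (0, 1)) /
        fderiv ℝ Φ (ρ, c) (0, 1) ^ 2) c := by
  have hγ : HasDerivAt (fun y : ℝ => ((ρ, y) : ℝ × ℝ)) ((0 : ℝ), (1 : ℝ)) c :=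
    (hasDerivAt_const c ρ).prodMk (hasDerivAt_id c)
  exact (hasDerivAt_fderiv_along hΦ hγ (1, 0)).div (hasDerivAt_fderiv_along hΦ hγ (0, 1)) hne

/-- Schwarz: the second derivative of a `C²` function is symmetric. -/
theorem sndFDeriv_symm {Φ : ℝ × ℝ → ℝ} (hΦ : ContDiff ℝ 2 Φ) (q u w : ℝ × ℝ) :
    fderiv ℝ (fderiv ℝ Φ) q u w = fderiv ℝ (fderiv ℝ Φ) q w u :=
  hΦ.contDiffAt.isSymmSndFDerivAt (by simp) u w

/-! ## The bulk identity (★) and the bulk transport -/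

/-- **Bulk leaf transport.**  Let `Φ` be `C²` and `ℓ` a level leaf over `[a,b]`
(`ℓ' = -Φ_ρ/Φ_c` within `[a,b]`, `Φ_c > 0` on the leaf).  If the `c`-derivative of the slope
`Φ_ρ/Φ_c` has size at most `Θ` at every leaf point, then `Φ_c` changes along the leaf by at most
the factor `exp (Θ |ρ - ρ'|)` — because `d/dρ log Φ_c(ρ, ℓ ρ) = ∂_c(Φ_ρ/Φ_c)(ρ, ℓ ρ)` (chain
rule and the symmetry of the second derivative). -/
theorem bulk_leaf_transport {Φ : ℝ × ℝ → ℝ} (hΦ : ContDiff ℝ 2 Φ) {a b Θ : ℝ} {ℓ : ℝ → ℝ}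
    (hℓ : ∀ ρ ∈ Set.Icc a b, HasDerivWithinAt ℓ
      (-(fderiv ℝ Φ (ρ, ℓ ρ) (1, 0) / fderiv ℝ Φ (ρ, ℓ ρ) (0, 1))) (Set.Icc a b) ρ)
    (hpos : ∀ ρ ∈ Set.Icc a b, 0 < fderiv ℝ Φ (ρ, ℓ ρ) (0, 1))
    (hR : ∀ ρ ∈ Set.Icc a b, ∀ R' : ℝ,
      HasDerivAt (fun y => fderiv ℝ Φ (ρ, y) (1, 0) / fderiv ℝ Φ (ρ, y) (0, 1)) R' (ℓ ρ) →
        |R'| ≤ Θ) :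
    ∀ ρ ∈ Set.Icc a b, ∀ ρ' ∈ Set.Icc a b,
      fderiv ℝ Φ (ρ, ℓ ρ) (0, 1) ≤ Real.exp (Θ * |ρ - ρ'|) * fderiv ℝ Φ (ρ', ℓ ρ') (0, 1) := by
  intro ρ hρ ρ' hρ'
  -- notation for the partials along the leaf
  set Pρ : ℝ → ℝ := fun x => fderiv ℝ Φ (x, ℓ x) (1, 0) with hPρ
  set Pc : ℝ → ℝ := fun x => fderiv ℝ Φ (x, ℓ x) (0, 1) with hPc
  set H : ℝ → (ℝ × ℝ) →L[ℝ] (ℝ × ℝ) →L[ℝ] ℝ := fun x => fderiv ℝ (fderiv ℝ Φ) (x, ℓ x) with hH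
  -- the `c`-derivative of the slope at the leaf point, and the derivative of `Pc`
  set R' : ℝ → ℝ := fun x =>
    (H x (0, 1) (1, 0) * Pc x - Pρ x * H x (0, 1) (0, 1)) / Pc x ^ 2 with hR'
  have hder : ∀ x ∈ Set.Icc a b, HasDerivWithinAt Pc (R' x * Pc x) (Set.Icc a b) x := by
    intro x hx
    have hγ : HasDerivWithinAt (fun y => ((y, ℓ y) : ℝ × ℝ)) ((1 : ℝ), -(Pρ x / Pc x))
        (Set.Icc a b) x := (hasDerivWithinAt_id x _).prodMk (hℓ x hx)
    have h := hasDerivWithinAt_fderiv_along hΦ hγ (0, 1)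
    refine h.congr_deriv ?_
    rw [clm₂_apply_prod, sndFDeriv_symm hΦ (x, ℓ x) (1, 0) (0, 1)]
    have hc : Pc x ≠ 0 := (hpos x hx).ne'
    simp only [hR', hH, hPρ, hPc] at hc ⊢
    field_simp
    ring
  have hbd : ∀ x ∈ Set.Icc a b, |R' x * Pc x| ≤ Θ * Pc x := by
    intro x hx
    rw [abs_mul, abs_of_pos (hpos x hx)]
    refine mul_le_mul_of_nonneg_right ?_ (hpos x hx).le
    exact hR x hx (R' x) (hasDerivAt_levelSlope hΦ x (ℓ x) (hpos x hx).ne')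
  exact le_exp_mul_abs_sub_mul_of_abs_deriv_le_mul (D := Pc) (D' := fun x => R' x * Pc x)
    hpos hder hbd hρ hρ'

/-! ## The corner (twin) identity and the corner transport -/

/-- **Local step of the corner transport.**  Let `Ψ` be `C²`, `e = (ρₑ, cₑ)` a level-`v` point with
`ρlo ≤ ρₑ < 1`, `c₀ ≤ cₑ < cb` and `Ψ_ρ e < 0`; assume `Ψ_c ≥ 0` on `[0,1] × [c₀,cb]` and
`|∂_ρ(Ψ_c/Ψ_ρ)| ≤ Θ` at the level-`v` points of `[ρlo,1] × [c₀,cb]`.  Then slightly above `cₑ` there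
is a level-`v` point `q` of `[ρlo,1] × (cₑ,cb]` with `|log (-Ψ_ρ q) - log (-Ψ_ρ e)| ≤ Θ (q.2 - cₑ)`:
follow the local leaf `ρ = ψ(c)` of the implicit function theorem (`ψ' = -Ψ_c/Ψ_ρ ≥ 0`, so `ρ`
does not decrease) and integrate the twin identity
`d/dc log(-Ψ_ρ(ψ c, c)) = ∂_ρ(Ψ_c/Ψ_ρ)(ψ c, c)`. -/
theorem corner_leaf_local {Ψ : ℝ × ℝ → ℝ} (hΨ : ContDiff ℝ 2 Ψ) {ρlo c₀ cb v Θ : ℝ} {e : ℝ × ℝ}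
    (hρlo : 0 < ρlo) (heρ : e.1 ∈ Set.Ico ρlo 1) (hec : e.2 ∈ Set.Ico c₀ cb) (hev : Ψ e = v)
    (hneg : fderiv ℝ Ψ e (1, 0) < 0)
    (hcnn : ∀ q : ℝ × ℝ, q.1 ∈ Set.Icc (0 : ℝ) 1 → q.2 ∈ Set.Icc c₀ cb → 0 ≤ fderiv ℝ Ψ q (0, 1))
    (hS : ∀ q : ℝ × ℝ, q.1 ∈ Set.Icc ρlo 1 → q.2 ∈ Set.Icc c₀ cb → Ψ q = v → ∀ S' : ℝ,
      HasDerivAt (fun r => fderiv ℝ Ψ (r, q.2) (0, 1) / fderiv ℝ Ψ (r, q.2) (1, 0)) S' q.1 →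
        |S'| ≤ Θ) :
    ∃ q : ℝ × ℝ, q.1 ∈ Set.Icc ρlo 1 ∧ q.2 ∈ Set.Ioc e.2 cb ∧ Ψ q = v ∧
      -fderiv ℝ Ψ q (1, 0) ≤ Real.exp (Θ * (q.2 - e.2)) * -fderiv ℝ Ψ e (1, 0) ∧
      -fderiv ℝ Ψ e (1, 0) ≤ Real.exp (Θ * (q.2 - e.2)) * -fderiv ℝ Ψ q (1, 0) := by
  obtain ⟨eρ, ec⟩ := e
  dsimp only at heρ hec hev hneg ⊢
  have hdiff : Differentiable ℝ Ψ := hΨ.differentiable (by norm_num)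
  -- the implicit function theorem in the FIRST variable: `f (c, ρ) := Ψ (ρ, c)` near `(ec, eρ)`
  set f : ℝ × ℝ → ℝ := fun p => Ψ (p.2, p.1) with hf_def
  have hf : ContDiff ℝ 2 f := hΨ.comp (contDiff_snd.prodMk contDiff_fst)
  have cdf : ContDiffAt ℝ 2 f (ec, eρ) := hf.contDiffAt
  have hfd : HasFDerivAt f ((fderiv ℝ Ψ (eρ, ec)).comp
      ((ContinuousLinearMap.snd ℝ ℝ ℝ).prod (ContinuousLinearMap.fst ℝ ℝ ℝ))) (ec, eρ) :=
    (hdiff (eρ, ec)).hasFDerivAt.comp (ec, eρ) (hasFDerivAt_snd.prodMk hasFDerivAt_fst)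
  have hfd_inr : ∀ x : ℝ, (fderiv ℝ f (ec, eρ) ∘L ContinuousLinearMap.inr ℝ ℝ ℝ) x =
      x * fderiv ℝ Ψ (eρ, ec) (1, 0) := by
    intro x
    rw [hfd.fderiv]
    simp only [ContinuousLinearMap.coe_comp, Function.comp_apply, ContinuousLinearMap.inr_apply,
      ContinuousLinearMap.prod_apply, ContinuousLinearMap.coe_snd', ContinuousLinearMap.coe_fst']
    have : ((x, (0 : ℝ)) : ℝ × ℝ) = x • ((1 : ℝ), (0 : ℝ)) := by ext <;> simp
    rw [this, map_smul, smul_eq_mul]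
  have hane : fderiv ℝ Ψ (eρ, ec) (1, 0) ≠ 0 := hneg.ne
  have hinv : (fderiv ℝ f (ec, eρ) ∘L ContinuousLinearMap.inr ℝ ℝ ℝ).IsInvertible := by
    refine ⟨ContinuousLinearEquiv.equivOfInverse
      (fderiv ℝ f (ec, eρ) ∘L ContinuousLinearMap.inr ℝ ℝ ℝ)
      ((fderiv ℝ Ψ (eρ, ec) (1, 0))⁻¹ • ContinuousLinearMap.id ℝ ℝ) (fun x => ?_) (fun x => ?_),
      rfl⟩
    · simp only [FunLike.coe_smul, Pi.smul_apply, ContinuousLinearMap.coe_id', id_eq,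
        smul_eq_mul, hfd_inr]
      field_simp
    · rw [hfd_inr]
      simp only [FunLike.coe_smul, Pi.smul_apply, ContinuousLinearMap.coe_id', id_eq, smul_eq_mul]
      field_simp
  set ψ : ℝ → ℝ := cdf.implicitFunction (by norm_num) hinv with hψ_def
  have hψe : ψ ec = eρ := cdf.implicitFunction_apply_self (by norm_num) hinv
  have hlev : ∀ᶠ c in 𝓝 ec, Ψ (ψ c, c) = v := by
    filter_upwards [cdf.eventually_apply_implicitFunction (by norm_num) hinv] with c hc
    simpa [hf_def, hev] using hc
  have hcd : ContDiffAt ℝ 2 ψ ec := cdf.contDiffAt_implicitFunction (by norm_num) hinv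
  -- eventual properties of the local leaf near `ec`
  have hψc : ContinuousAt ψ ec := hcd.continuousAt
  have hcurve : ContinuousAt (fun c => ((ψ c, c) : ℝ × ℝ)) ec := hψc.prodMk continuousAt_id
  have hF : Continuous fun q : ℝ × ℝ => fderiv ℝ Ψ q (1, 0) :=
    (hΨ.continuous_fderiv (by norm_num)).clm_apply continuous_const
  have ev1 : ∀ᶠ c in 𝓝 ec, DifferentiableAt ℝ ψ c := by
    filter_upwards [hcd.eventually (by simp)] with c hc using hc.differentiableAt (by norm_num)
  have ev2 : ∀ᶠ c in 𝓝 ec, ∀ᶠ c' in 𝓝 c, Ψ (ψ c', c') = v := hlev.eventually_nhds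
  have ev3 : ∀ᶠ c in 𝓝 ec, fderiv ℝ Ψ (ψ c, c) (1, 0) < 0 := by
    have ht : Tendsto (fun c => fderiv ℝ Ψ (ψ c, c) (1, 0)) (𝓝 ec)
        (𝓝 (fderiv ℝ Ψ (ψ ec, ec) (1, 0))) := hF.continuousAt.tendsto.comp hcurve
    rw [hψe] at ht
    exact ht.eventually_lt_const hneg
  have ev4 : ∀ᶠ c in 𝓝 ec, ψ c < 1 := by
    have ht : Tendsto ψ (𝓝 ec) (𝓝 (ψ ec)) := hψc
    rw [hψe] at ht
    exact ht.eventually_lt_const heρ.2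
  have ev5 : ∀ᶠ c in 𝓝 ec, 0 < ψ c := by
    have ht : Tendsto ψ (𝓝 ec) (𝓝 (ψ ec)) := hψc
    rw [hψe] at ht
    exact ht.eventually_const_lt (hρlo.trans_le heρ.1)
  obtain ⟨ε, hε, hball⟩ :=
    Metric.eventually_nhds_iff.1 (ev1.and (ev2.and (ev3.and (ev4.and ev5))))
  -- the interval `I = [ec, c']`
  set ε' : ℝ := min (ε / 2) ((cb - ec) / 2) with hε'
  have hε'pos : 0 < ε' := lt_min (by linarith) (by linarith [hec.2])
  set c' : ℝ := ec + ε' with hc'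
  have hI : ∀ c ∈ Set.Icc ec c', dist c ec < ε ∧ c ∈ Set.Icc c₀ cb := by
    intro c hc
    refine ⟨?_, ⟨hec.1.trans hc.1, ?_⟩⟩
    · rw [Real.dist_eq, abs_of_nonneg (by linarith [hc.1])]
      calc c - ec ≤ ε' := by linarith [hc.2]
        _ ≤ ε / 2 := min_le_left _ _
        _ < ε := by linarith
    · calc c ≤ ec + ε' := hc.2
        _ ≤ ec + (cb - ec) / 2 := by gcongr; exact min_le_right _ _
        _ ≤ cb := by linarith [hec.2]
  -- partials along the local leaf
  set Pρ : ℝ → ℝ := fun c => fderiv ℝ Ψ (ψ c, c) (1, 0) with hPρ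
  set Pc : ℝ → ℝ := fun c => fderiv ℝ Ψ (ψ c, c) (0, 1) with hPc
  set H : ℝ → (ℝ × ℝ) →L[ℝ] (ℝ × ℝ) →L[ℝ] ℝ := fun c => fderiv ℝ (fderiv ℝ Ψ) (ψ c, c) with hH
  set S' : ℝ → ℝ := fun c =>
    (H c (1, 0) (0, 1) * Pρ c - Pc c * H c (1, 0) (1, 0)) / Pρ c ^ 2 with hS'
  have hneg' : ∀ c ∈ Set.Icc ec c', Pρ c < 0 := fun c hc => (hball (hI c hc).1).2.2.1
  have hlt1 : ∀ c ∈ Set.Icc ec c', ψ c < 1 := fun c hc => (hball (hI c hc).1).2.2.2.1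
  have hpos0 : ∀ c ∈ Set.Icc ec c', 0 < ψ c := fun c hc => (hball (hI c hc).1).2.2.2.2
  have hlevI : ∀ c ∈ Set.Icc ec c', Ψ (ψ c, c) = v := fun c hc =>
    (hball (hI c hc).1).2.1.self_of_nhds
  -- the leaf ODE `ψ' = -Ψ_c/Ψ_ρ` on `I` (differentiate `Ψ (ψ c, c) = v`)
  have hode : ∀ c ∈ Set.Icc ec c', HasDerivAt ψ (-(Pc c / Pρ c)) c := by
    intro c hc
    obtain ⟨h1, h2, -, -, -⟩ := hball (hI c hc).1
    have hd : HasDerivAt ψ (deriv ψ c) c := h1.hasDerivAt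
    have hγ : HasDerivAt (fun y => ((ψ y, y) : ℝ × ℝ)) (deriv ψ c, (1 : ℝ)) c :=
      hd.prodMk (hasDerivAt_id c)
    have hcomp : HasDerivAt (fun y => Ψ (ψ y, y)) (fderiv ℝ Ψ (ψ c, c) (deriv ψ c, 1)) c :=
      HasFDerivAt.comp_hasDerivAt (f := fun y : ℝ => ((ψ y, y) : ℝ × ℝ)) c
        (hdiff (ψ c, c)).hasFDerivAt hγ
    have hconst : HasDerivAt (fun y => Ψ (ψ y, y)) 0 c :=
      (hasDerivAt_const c v).congr_of_eventuallyEq h2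
    have heq : fderiv ℝ Ψ (ψ c, c) (deriv ψ c, 1) = 0 := hcomp.unique hconst
    rw [clm_apply_prod] at heq
    have hρne : Pρ c ≠ 0 := (hneg' c hc).ne
    have hval : deriv ψ c = -(Pc c / Pρ c) := by
      simp only [hPρ, hPc] at hρne ⊢
      field_simp
      linarith [heq]
    rw [← hval]
    exact hd
  -- `ψ` does not decrease on `I`, so the leaf stays in `ρ ≥ ρlo`
  have hmono : MonotoneOn ψ (Set.Icc ec c') := by
    refine monotoneOn_of_hasDerivWithinAt_nonneg (convex_Icc ec c')
      (fun x hx => (hode x hx).continuousAt.continuousWithinAt)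
      (fun x hx => (hode x (interior_subset hx)).hasDerivWithinAt) (fun x hx => ?_)
    have hx' : x ∈ Set.Icc ec c' := interior_subset hx
    have h1 : 0 ≤ Pc x :=
      hcnn (ψ x, x) ⟨(hpos0 x hx').le, (hlt1 x hx').le⟩ (hI x hx').2
    have h2 : Pρ x < 0 := hneg' x hx'
    have : Pc x / Pρ x ≤ 0 := div_nonpos_iff.2 (Or.inl ⟨h1, h2.le⟩)
    linarith
  have hlo : ∀ c ∈ Set.Icc ec c', ρlo ≤ ψ c := by
    intro c hc
    have h := hmono (Set.left_mem_Icc.2 (hc.1.trans hc.2)) hc hc.1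
    rw [hψe] at h
    exact heρ.1.trans h
  -- the twin identity: `D = -Ψ_ρ` along the leaf satisfies `D' = ∂_ρ(Ψ_c/Ψ_ρ) · D`
  have hDpos : ∀ c ∈ Set.Icc ec c', 0 < -Pρ c := fun c hc => by linarith [hneg' c hc]
  have hDder : ∀ c ∈ Set.Icc ec c',
      HasDerivWithinAt (fun y => -Pρ y) (S' c * -Pρ c) (Set.Icc ec c') c := by
    intro c hc
    have hγ : HasDerivAt (fun y => ((ψ y, y) : ℝ × ℝ)) (-(Pc c / Pρ c), (1 : ℝ)) c :=
      (hode c hc).prodMk (hasDerivAt_id c)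
    have h := (hasDerivAt_fderiv_along hΨ hγ (1, 0)).neg
    refine (h.congr_deriv ?_).hasDerivWithinAt
    rw [clm₂_apply_prod, sndFDeriv_symm hΨ (ψ c, c) (0, 1) (1, 0)]
    have hρne : Pρ c ≠ 0 := (hneg' c hc).ne
    simp only [hS', hH, hPρ, hPc] at hρne ⊢
    field_simp
    ring
  have hDbd : ∀ c ∈ Set.Icc ec c', |S' c * -Pρ c| ≤ Θ * -Pρ c := by
    intro c hc
    rw [abs_mul, abs_of_pos (hDpos c hc)]
    refine mul_le_mul_of_nonneg_right ?_ (hDpos c hc).le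
    exact hS (ψ c, c) ⟨hlo c hc, (hlt1 c hc).le⟩ (hI c hc).2 (hlevI c hc) (S' c)
      (hasDerivAt_levelInvSlope hΨ (ψ c) c (hneg' c hc).ne)
  -- integrate along `I`
  have hcI : c' ∈ Set.Icc ec c' := Set.right_mem_Icc.2 (by linarith)
  have heI : ec ∈ Set.Icc ec c' := Set.left_mem_Icc.2 (by linarith)
  have h1 := le_exp_mul_abs_sub_mul_of_abs_deriv_le_mul (D := fun y => -Pρ y)
    (D' := fun c => S' c * -Pρ c) hDpos hDder hDbd hcI heI
  have h2 := le_exp_mul_abs_sub_mul_of_abs_deriv_le_mul (D := fun y => -Pρ y)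
    (D' := fun c => S' c * -Pρ c) hDpos hDder hDbd heI hcI
  have habs : |c' - ec| = c' - ec := abs_of_pos (by linarith)
  rw [habs] at h1
  rw [abs_sub_comm, habs] at h2
  refine ⟨(ψ c', c'), ⟨hlo c' hcI, (hlt1 c' hcI).le⟩, ⟨by show ec < c'; linarith, (hI c' hcI).2.2⟩,
    hlevI c' hcI, ?_, ?_⟩
  · simpa only [hPρ, hψe] using h1
  · simpa only [hPρ, hψe] using h2

end Summit.CriticalPhenomena.CardyFormulaZ2.Theorems.CardySelfRefinement

end
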